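import Mathlib
import HarnessLib
import HarnessLib.Audit
import Summits.QuantumAdvantage.Statement
import Literature.Computability.QuantumComplexity.StabilizerRankOver
import Literature.Computability.Complexity.ProbabilisticClassesProofs
import HarnessLib.Audit.Status.Attr

/-!
Route: ModularRank

DORMANT since 2026-08-23T04:28:16Z (reconciler: no traction for 5.9 d (last activity statement-grounded at 2026-08-17T06:24:47Z); parked, not closed — `ledger route dormant route-QuantumAdvantage-ModularRank --off` to reactivate) — unstaffed, not closed; items shared with open routes are served there. `ledger route dormant <id> --off` reactivates.

Route ModularRank (realises idea card
QuantumAdvantage/QuantumAdvantage/specialize-the-angle-reduce-the-prime: its "reduce the prime"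
functor, made two-sided). NEGATION side (targets ¬Statement, quantum-advantage.S02), the
exact/arithmetic twin of route Dequantize.
THESIS X (words): every language decided with error ≤ 1/3 by a poly-time-uniform Clifford+T family
is in BPP — reached through P: a Clifford+T acceptance probability is an EXACT number N/2^h with N ∈
ℤ[√2] ⊂ ℤ[ζ₈] and |N|, |τN| ≤ 2^h (h = Hadamard count, τ: √2 ↦ −√2), so a classical simulator may
compute N modulo primes p ≡ 1 (mod 8) — where ζ₈ ∈ 𝔽_p, unnormalised stabilizer vectors (entries in
ℤ[i]) and Σ_x ζ₈^{|x|}|x⟩ ∝ |T⟩^{⊗t} reduce to 𝔽_p-vectors and stabilizer rank becomes a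
finite-field invariant χ_p(T^{⊗t}) free of archimedean conditioning — and recover N by the Chinese
remainder theorem from h+2 primes.
Lean: X := Literature.Computability.Cryptography.BQP ⊆ Literature.Computability.Complexity.BPP (item
Target; the same statement as Dequantize.DeqThesis — an alternative decomposition sharing the decl).
IT SUFFICES (frame): Assembly := ModularSimulation → ModularRankPoly → ¬ QuantumAdvantage, PROVED in
the route file as the deciding theorem `closes` (rev 3: BQP ⊆ Classes.P from the two items — the
hypothesis of ModularSimulation is the body of ModularRankPoly verbatim — then P ⊆ BPP by the
discharged tree theorem P_subset_BPP_holds; the existential summit form needs no BPP ⊆ BQP, so that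
former hypothesis is gone), where
 • ModularRankPoly (crux, HYPOTHESIS-type, consensus-false, staffed for refutation and census): some
poly-time D maps unary (t,k) to k distinct primes p ≡ 1 (8) with roots r (r⁴ = −1 in ZMod p) and,
per prime, at most (t+k)^c + c T-free Clifford+T circuits C_j with coefficients c_j ∈ ZMod p such
that (x ↦ r^{|x|}) = Σ_j c_j • ev_p(C_j)|0^t⟩ over ZMod p (ev_p: H ↦ [[1,1],[1,−1]], S ↦ diag(1,r²),
CNOT, first gate first);
 • ModularSimulation (crux, theorem-target, new): ModularRankPoly → BQP ⊆ Classes.P (Bravyi–Gosset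
T-gadgets with exact postselection weight 2^{−t}; N = Σ_y ψ'_y·conj(ψ'_y) computed mod p from the
modular decomposition and exact bilinear stabilizer pairings over ℤ[ζ₈]; conj and τ act on |T⟩
through the Cliffords ZS and Z, so one root per prime suffices; CRT; compare N/2^h with 1/2).
KILL ITEMS (S-side, filed as cruxes so they are staffed; note ¬ModularRankPoly is itself a
CONSEQUENCE of the summit, since BQP ≠ P ⟹ ¬ModularRankPoly by ModularSimulation, and the filed
kills are its natural uniform strengthenings): ModularRankSuperpoly (∀c ∃t≥2 ∀p≡1(8) ∀r: every
modular decomposition of T^{⊗t} has more than t^c + c terms) ⟹ ¬ModularRankPoly (support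
SuperpolyKillsPoly); with the transfer lemma ModularRankTransfer (card Thm P1: modular k-term
representability ⟺ complex k-term representability for all p > P₀(t)) it yields ExactRankSuperpoly
(superpolynomial EXACT stabilizer rank of tensorPow magicT t over ℂ — the δ = 0 shadow of
Dequantize's kill item 0247, previously unfiled) via support ModularToExact.

Rationale: WHY THIS LINE. Route Dequantize hosts the hub's one refutable dequantisation object, the APPROXIMATE
stabilizer rank χ_δ(T^⊗t), whose lower bounds stall at Ω̃(t²) behind archimedean obstacles
(ill-conditioned stabilizer frames, arXiv:2503.04101 Thm 1; arXiv:2106.03214 p.6). The idea card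
specialize-the-angle-reduce-the-prime observes that the EXACT problem is arithmetic: unnormalised
stabilizer vectors lie in ℤ[i]^{2^t} and Σ_x ζ₈^{|x|}|x⟩ in ℤ[ζ₈]^{2^t}, so "χ ≤ r" is a statement
about minors over ℤ[ζ₈,1/2] with a value modulo every prime, equal to the complex value for all but
finitely many p per t (card Thm P1 = item ModularRankTransfer). This route makes the functor
TWO-SIDED, which is what makes it route-shaped: Clifford+T acceptance probabilities are exact
numbers N/2^h, N ∈ ℤ[√2], |N|,|τN| ≤ 2^h (Adleman–DeMarrais–Huang 1997: amplitudes are GapP/√2^h,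
tree fact BQP_subset_PP), so polynomial MODULAR stabilizer rank at polynomially many primes p ≡ 1
(8) gives — by Bravyi–Gosset gadgetisation (arXiv:1601.07601 §2–4, P_out = 2^t⟨…⟩, postselection
weight exactly 2^{−t}), exact stabilizer pairings (arXiv:quant-ph/0406196 §III; BG16 §3) reduced mod
p, and the Chinese remainder theorem — a DETERMINISTIC polynomial-time simulation, BQP ⊆ P (item
ModularSimulation). Hence quantum advantage (already BQP ≠ P) FORCES superpolynomial modular magic
at all but polynomially few primes: the card's finite-field engine C3 is a necessary condition for
the summit and becomes the route's typed, staffed kill item, beside its archimedean shadow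
ExactRankSuperpoly (δ = 0 half of Dequantize's 0247; weaker; previously unfiled). Imported areas:
algebraic number theory of the Clifford+T ring ℤ[ζ₈,1/2] (Giles–Selinger arXiv:1212.0506; the Galois
twists of |T⟩ are the Cliffords Z, ZS), reduction mod p + CRT (computer algebra), finite-field
linear algebra / coding theory on the kill side. The thesis X = BQP ⊆ BPP is consensus-FALSE (Shor;
BV97 Thm 8.10 oracle evidence) exactly as for Dequantize: the route exists to EARN
ModularSimulation, ModularRankTransfer and the glue, to run the exceptional-primes census (card C1),
and to hand the S-side arithmetic targets free of conditioning obstructions. No physical analogy is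
used.
RANKED CRUXES. (2) ModularSimulation [theorem-target, new-combination]: ModularRankPoly → BQP ⊆
Classes.P. Why it might fail: as typed only — tree BQP/P conventions (wire-0 acceptance, IsUniform
encodings), the (t,k)-indexed decomposition oracle, bilinear (not sesquilinear) stabilizer pairings
Σ_y α_y β_y over ℤ[ζ₈] and their reduction; each step is in print over ℂ. (3) ModularRankPoly
[hypothesis-type, consensus-false; staff refuters/kit, not provers]. Why it might fail: it is
expected to — a rank-r modular coincidence imposes 2^t − r linear conditions mod p, so exceptional
primes below 2^{poly(t)} should not exist for large t and the hypothesis is heuristically as false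
as polynomial exact rank; the census (support ModularCensus) is its first empirical test and nobody
has the data. (4) ModularRankSuperpoly [S-side kill]: ∀c ∃t≥2 ∀p≡1(8) ∀r(r⁴=−1), every T-free
modular decomposition of x ↦ r^{|x|} has > t^c + c terms. Why it might fail: a fixed small prime (p
= 17, r = 2) may carry unexpected low-rank identities (census decides cheaply for t ≤ 4), and at
large p it contains the classical open problem (PSV22 Thm 1.1 gives only Ω(t); a superlinear bound
already settles Williams' quadratic-uncertainty question, PSV22 §1.4; superpolynomial known only
conditionally, arXiv:2305.10277 Thm 1.6). (5) ExactRankSuperpoly [S-side classical core]: ∀c ∃t, t^c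
+ c < stabilizerRank (tensorPow magicT t). Why it might fail: polynomial exact rank is excluded by
no theorem (upper exponent log₂3/4 ≈ 0.396: doi:10.22331/q-2021-12-20-606, Kocia 2021; lower bound
Ω(t)).
SUPPORT. ModularRankTransfer (card Thm P1; provable now: finitely many stabilizer directions via
Dehaene–De Moor 2003 / Van den Nest 2010, certifying minors, ℚ(ζ₈)-rationality of spans);
SuperpolyKillsPoly (logic: k = 1, c ↦ 2c using t ≥ 2); ModularToExact (Superpoly → Transfer → Exact:
a prime ≡ 1 (8) above P₀ by Nat.exists_prime_gt_modEq_one, an r with r⁴ = −1 in ZMod p, nonemptiness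
of complex decompositions via X = HSSH); ModularCensus (informal; kit job: χ_p vs χ_ℂ of T^⊗n, n ≤
4, p ≡ 1 (8), p < 200).
KILL CRITERIA. ModularRankSuperpoly, or any Theorems proof of ¬ModularRankPoly ⇒ route closes
refuted:ModularRankPoly with ModularSimulation/Transfer kept as earned theorems — the intended
scientific outcome. Census with χ_p = χ_ℂ for all n ≤ 4, p < 200 ⇒ route goes dormant as a target
(hypothesis empirically as dead as poly exact rank); items stay wanted by the S-side. Census with
rank DROPS mod small primes ⇒ expand (3): density of exceptional primes becomes the live question
(card C1's "arithmetic magic monotone").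
NOT DECOMPOSED YET. The card's angle half (generic angle = joint Dicke rank, LS22 §5 — published; "T
sub-generic for all n ≥ 2" ornamental here); 𝔽_{p²} for p ≢ 1 (8); δ-approximate versions (reduction
mod p cannot see χ_δ — stated limitation of the line); PSV-over-𝔽_p (Ω(t) should transfer verbatim)
and the relation-code / coset-weight formulation of (4) — provers attach such lemmas with --supports
ModularRankSuperpoly; a field-generic definition stabilizerRankOver is requested so later
restatements are short. Two layers only; no split before a crux closes.
SOURCES. arXiv:2106.03214 (PSV22), arXiv:2110.07781 (LS22), arXiv:2305.10277 (MT24),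
arXiv:2503.04101 (KS25), arXiv:1601.07601 (BG16), arXiv:1808.00128 (BBCCGH19),
arXiv:quant-ph/0406196 (AG04), AdlemanDeMarraisHuang1997, arXiv:1212.0506 (Giles–Selinger 2013),
doi:10.22331/q-2021-12-20-606 (QPG21), doi:10.2172/1856735 (Kocia 2021), arXiv:2107.10551 (Labib22),
BernsteinVazirani1997 §8, quant-ph/0304125 (Dehaene–De Moor 2003), arXiv:0811.0898 (Van den Nest
2010).

Novelty: NOVELTY (searched 2026-08-15 BEFORE claiming; local FTS daemon down (connection reset) and
arXiv/S2/OpenAlex HTTP 429 this hour, so the remote cascade was zbMATH + Crossref + galaxy): zbMATH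
"stabilizer rank" (15 rows, 0 relevant); Crossref "stabilizer rank magic state finite field modular"
(Kocia 2021 doi:10.2172/1856735 and Qassim–Pashayan–Gosset 2021 doi:10.22331/q-2021-12-20-606 —
upper bounds only); `lit galaxy search "stabilizer rank" --star all` (11 pdf hits: BBCCGH19, Labib
thesis DS-2022-03, Lovitz NSF project description, ZX-cutting arXiv:2403.10964, Pashayan et al.
arXiv:2101.12223, Dias–König Quantum 2024 — none modular); galaxy substring "stabilizer
decomposition over finite fields" and "Chinese remainder quantum circuit amplitude" (0 and 0);
galaxy --mode intelligent "classical simulation of Clifford+T … stabilizer rank over a finite field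
or modulo a prime" (12 hits, none on topic); `lit read arXiv:2106.03214 --grep` (p.5: T_n = Σ_j b_j
M_j mod-8 remark, Cramer bound on coefficients, §1.4 quadratic-uncertainty link) and
arXiv:2110.07781 p.13 Fact 5.1; plus the card's own reads (PSV22, MT24, KS25) and novelty-audit-9's
READ of LS22 §5; sibling cards checked by title/mechanism line (stabilizer-frame-conditioning,
every-certificate-of-magic-is-a-code, counterfeit-magic-dichotomy, magic-asymptotic-spectrum,
exact-advantage-galois-rewiring, dark-band-floor, kummer-sector-language).
NEAREST PRIOR ART. (1) Bravyi–Gosset 2016 arXiv:1601.07601 / Bravyi–Smith–Smolin 2016  [refs: 10.2172/1856735, 10.22331/q-2021-12-20-606, 2403.10964, 2101.12223, 2106.03214, 2110.07781, 1601.07601, 1808.00128, 2305.10277, 1212.0506, 2107.10551, doi:10.2172/1856735, doi:10.22331/q-2021-12-20-606]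

Barriers (technique_class: simulation, stabilizer-rank, dequantization, mod-p, CRT): Literature.Barriers.QuantumAdvantage.Relativization: names this thesis shape
(Relativization.not_relativizes_collapse_shape — no relativizing proof of O ↦ BQP^O ⊆ BPP^O at O =
∅, contrary oracle exists_oracle_BQPRel_not_subset_BPPRel, BV97 Thm 8.10/Cor 8.14). EVADED in kind,
as for Dequantize: the modular simulator is non-black-box — it consumes the explicit Clifford+T gate
list (T-gadgets, evaluation of Clifford words over ZMod p, exact pairings, CRT on exact amplitudes);
an oracle gate has no modular stabilizer decomposition and ModularSimulation says nothing about
BQP^O.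
Literature.Barriers.QuantumAdvantage.Algebrization: Algebrization.not_isAlgebrizingInclusion_bqp_bpp
(Aaronson–Wigderson 2008 Thm 5.11(v), "proving BPP = BQP will require non-algebrizing techniques").
Same verdict: not an inclusion argument C^A ⊆ D^Ã, no arithmetization of an oracle; it uses the gate
set.
Literature.Barriers.QuantumAdvantage.NaturalProofs: concerns natural properties useful against
P/poly (route CircuitLB). The S-side kill items here (ModularRankSuperpoly, ExactRankSuperpoly) are
lower bounds in a LINEAR model (fewest stabilizer functions summing to x ↦ ζ₈^{|x|}), decidable by
Gaussian elimination over 𝔽_p in time poly(2^t, #Stab_t): constructive and large as a property of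
STATES, but not a property of Boolean functions against circuits — RR not engaged. Recorded
honestly: PSV22 §1.4 shows a superlinear exact bound already implies a superlinear bound in
Williams' quadratic-uncertainty mode

Novelty grade: new-combination — Route review grade (refuter, 2026-08-15). Search this session (searchd rc 75, S2 HTTP 429; used arXiv API 'stabilizer rank' 25 rows, Crossref x4, galaxy substring 'stabilizer rank over finite field' 0/0/0 and intelligent 'Clifford+T amplitudes modulo a prime Chinese remainder' 15 rows none on topic; (refuter operator:999:1630528, 2026-08-15T12:34:07Z; prior: arXiv:1601.07601 Bravyi–Gosset 2016 (T-gadget / stabilizer-rank simulator skeleton), AdlemanDeMarraisHuang1997 + arXiv:1212.0506 Giles–Selinger 2013 (amplitudes in 2^{-h/2}ℤ[ζ₈]: the integrality making CRT possible), arXiv:2106.03214 PSV22; arXiv:2305.10277 MT24 Thm 1.6 (exact-rank lower bounds; archimedean analogue of the P=PP collapse remark), doi:10.1098/rspa.1999.0485 Fenner–Green–Homer–Pruim )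

History (route lifecycle, newest last):
- 2026-08-15T16:14:56Z · rev 3: restated Assembly (stmt-QuantumAdvantage-1798) — route-repair (glue): Assembly restated without the unused hypothesis BPP_subset_BQP (glue.extra-hypothesis); import Literature.Computability.Complexity.Probabil (planner-rbadge-QuantumAdvantage-ModularRank-3d03a5a5-g2-0)
- 2026-08-23T04:28:16Z · DORMANT — reconciler: no traction for 5.9 d (last activity statement-grounded at 2026-08-17T06:24:47Z); parked, not closed — `ledger route dormant route-QuantumAdvantage- (operator:999:1476222)

sub-problem: QuantumAdvantage · status: dormant · opened planner-plancard-QuantumAdvantage-QuantumAdva-27c457dd-0 2026-08-15T10:58:48Z · rev 6 · ledger route-QuantumAdvantage-ModularRank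
GENERATED by the gate from the ledger (D-0016/17). Provers cite these decls: `theorem foo : Summit.QuantumAdvantage.QuantumAdvantage.Theses.ModularRank.<Decl> := …` in Summits/QuantumAdvantage/QuantumAdvantage/Theorems/<Name>.lean.
-/

namespace Summit.QuantumAdvantage.QuantumAdvantage.Theses.ModularRank

open scoped BigOperators Topology Manifold Classical MeasureTheory ProbabilityTheory Matrix InnerProductSpace ComplexConjugate ContinuousMap
open Filter Set Function TopologicalSpace MeasureTheory

attribute [summit_statement] _root_.QuantumAdvantage

open Literature.QuantumAdvantage

/-- item stmt-QuantumAdvantage-0242 · target · rank 0 · open · by planner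
why it might fail: X = BQP ⊆ BPP puts FACTORING in BPP (tree theorem FACT_mem_BQP_holds) and contradicts the oracle picture BQP^O ⊄ BPP^O (BV97 Thm 8.10/Cor 8.14; tree exists_oracle_BQPRel_not_subset_BPPRel_holds, Relativization_holds); every dequantisation in print costs 2^{βt} in some magic monotone (BG16, QPG21).
sources: BernsteinVazirani1997 §8 Thm 8.10 / Cor 8.14 (recursive Fourier sampling oracle), tree theorem Literature.Computability.Cryptography.FACT_mem_BQP_holds (Literature/Computability/Cryptography/ShorAssemblyLeavesProofs.lean:92): FACTORING ∈ BQP is proved in the tree, tree theorems exists_oracle_BQPRel_not_subset_BPPRel_holds (Literature/Computability/QuantumComplexity/OracleSeparationsProofs.lean:105) and Literature.Barriers.QuantumAdvantage.Relativization_holds (RelativizationProofs.lean:47), arXiv:1601.07601 (Bravyi–Gosset 2016) eq. (2): simulation cost 2^{βt}·poly(n), β < 1/2; doi:10.22331/q-2021-12-20-606 (Qassim–Pashayan–Gosset 2021: exponent 0.3963), route Dequantize item stmt-QuantumAdvantage-0242 (DeqThesis = the same decl, shared target; kind target there since retriage 2026-08-14)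
Thesis X of route Dequantize, targeting ¬QuantumAdvantage (quantum-advantage.S02, BQP = BPP): every
uniform Clifford+T family with error 1/3 is simulable in BPP. [BernsteinVazirani1997 §8;
BravyiGosset2016] -/
@[route_item "route-QuantumAdvantage-ModularRank"]
def Target : Prop :=
  Literature.Computability.Cryptography.BQP ⊆ Literature.Computability.Complexity.BPP

/-- item stmt-QuantumAdvantage-17857 · crux · rank 3 · open · by planner
why it might fail: Consensus-FALSE: density ∀k at fixed span t^c+c ⇒ infinitely many cheap primes per t ⇒ (finitely many stabilizer directions + minor norms) χ_ℂ(T^⊗t) ≤ t^c+c ∀t ⇒ P^#P ⊆ P/poly (MT24 Thm 1.6, tree); killed by ModularRankSuperpoly (k=1) or ExactRankSuperpoly+transfer; census t≤3: no rank drop p<200.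
sources: tree Literature/Computability/QuantumComplexity/StabilizerRankOver.lean (magicVectorOver, modGateEval, RepresentableOver.map, stabilizerRankOver_map_le, modGateEval_eq_inline), Cruxes/ModularRankPoly/Split.lean @f075664164d8 (Split.ModularRankPoly_of_subs: this piece ∧ DecomposerListingPolyTime → ModularRankPoly, rc0, 0 sorry), arXiv:2305.10277 Thm 1.6 (p.5) = tree MehrabanTahmasbi2024_PSharpP_subset_PPoly_of_stabilizerRank_poly_holds (poly exact rank ⇒ P^#P ⊆ P/poly), arXiv:2106.03214 Thm 1.1 (PSV22: χ(T^{⊗n}) = Ω(n), the only unconditional lower bound; p.4 'uniformity issues having to do with finding the decomposition'), evidence stmt-QuantumAdvantage-1851/ModularCensus_n_le_3.md (χ_p = χ_ℂ for t ≤ 3 at all p ≡ 1 (8) < 200), route items stmt-QuantumAdvantage-1793 ModularRankSuperpoly / 1794 ExactRankSuperpoly / 1795 ModularRankTransfer (kill path and transfer mechanism)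
[crux] HYPOTHESIS-TYPE, CONSENSUS-FALSE (refuters / kit census first; provers: do not attempt a
direct proof) — the ARITHMETIC piece of ModularRankPoly, cut at the prime (strategist split
2026-08-17, Cruxes/ModularRankPoly/Split.lean). ∃ c d P F: a poly-time (unary (t,p)) recogniser P t
p of 'cheap-magic' primes; DENSITY: for all t k at least k primes p ≡ 1 (mod 8) with P t p below
(t+k)^d + d; and a poly-time (unary (t,p)) per-prime DECOMPOSER F t p = (r, L) returning, at every
good prime, a primitive 8th root r (r⁴ = −1 in ZMod p) and ≤ t^c + c pairs (T-free oracle-free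
Clifford circuit C, coefficient a) with magicVectorOver r t = Σ a • modGateEval r C e₀ over ZMod p
(named integral Clifford dictionary of
Literature/Computability/QuantumComplexity/StabilizerRankOver.lean: x ↦ r^{|x|}; √2·H, diag(1,r²),
CNOT; agrees with the parent's inline ev on T-free words, modGateEval_eq_inline). With
DecomposerListingPolyTime it gives ModularRankPoly (glue PROVED: Split.ModularRankPoly_of_subs).
READING: 'exceptional primes are polynomially dense among SMALL primes, recognisable, and uniformly
decomposable'. NOTE FOR REFUTERS: density for every k at the fixed span size t^c + c forces infinite -/
@[route_item "route-QuantumAdvantage-ModularRank"]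
def DenseModularDecomposer : Prop :=
  ∃ c d : ℕ, ∃ P : ℕ → ℕ → Bool, ∃ F : (t : ℕ) → ℕ → ℕ × List (Literature.Computability.Cryptography.QCircuit Literature.Computability.Cryptography.cliffordT t × ℕ), Literature.Computability.Complexity.PolyTimeComputable (fun q : ℕ × ℕ => Literature.Computability.Complexity.boolPair (Computability.unaryEncodeNat q.1) (Computability.unaryEncodeNat q.2)) Computability.encodeBool (fun q => P q.1 q.2) ∧ Literature.Computability.Complexity.PolyTimeComputable (fun q : ℕ × ℕ => Literature.Computability.Complexity.boolPair (Computability.unaryEncodeNat q.1) (Computability.unaryEncodeNat q.2)) (fun o : (Σ t : ℕ, ℕ × List (Literature.Computability.Cryptography.QCircuit Literature.Computability.Cryptography.cliffordT t × ℕ)) => Literature.Computability.Complexity.boolPair (Computability.encodeNat o.1) (Literature.Computability.Complexity.boolPair (Computability.encodeNat o.2.1) ((o.2.2.map fun x => Literature.Computability.Complexity.boolPair x.1.encode (Computability.encodeNat x.2)).foldr Literature.Computability.Complexity.boolPair []))) (fun q => ⟨q.1, F q.1 q.2⟩) ∧ (∀ t k : ℕ, k ≤ ((List.range ((t + k) ^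 d + d)).filter fun p => decide (p.Prime ∧ p % 8 = 1 ∧ P t p = true)).length) ∧ ∀ t p : ℕ, p.Prime → p % 8 = 1 → P t p = true → ((F t p).1 : ZMod p) ^ 4 = -1 ∧ (F t p).2.length ≤ t ^ c + c ∧ (∀ x ∈ (F t p).2, x.1.IsOracleFree ∧ x.1.tCount = 0) ∧ Literature.Computability.QuantumComplexity.magicVectorOver ((F t p).1 : ZMod p) t = ((F t p).2.map fun x => (x.2 : ZMod p) • (Literature.Computability.QuantumComplexity.modGateEval ((F t p).1 : ZMod p) x.1).mulVec (Pi.single (fun _ => false) 1 : Literature.Computability.Cryptography.QReg t → ZMod p)).sum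

/-- item stmt-QuantumAdvantage-1792 · crux · rank 3 · open · by planner
why it might fail: Consensus-FALSE: modular-CRT evaluation is EXACT, so the hypothesis puts exact Clifford+T amplitudes in FP ⇒ GapP ⊆ FP, P = PP = PostBQP (tree PostBQP_eq_PP_eq; MT24 Thm 1.6 Hadamard test, tree-formalised); a k-term identity mod p costs ~2^t−k conditions; census t≤3: χ_p = χ_ℂ at all p≡1(8)<200.
sources: tree theorem PostBQP_eq_PP_eq : PostBQP = PP (Literature/Computability/Cryptography/PostselectionPostBQPEqPPProofs.lean:64; Aaronson 2005 Thm 2) — PostBQP is over uniform Clifford+T families (Postselection.lean:221), exactly what the modular simulator evaluates exactly, tree theorem MehrabanTahmasbi2024_PSharpP_subset_PPoly_of_stabilizerRank_poly_holds (Literature/Computability/QuantumComplexity/StabilizerRankPermanentProofs.lean:413) with SharpPHadamardCore.lean: the GapP encoding of arXiv:2305.10277 p.5 (proof of Thm 1.6) is formalised, arXiv:2305.10277 p.5: ⟨0ⁿ1|H^{⊗n+1}U_f H^{⊗n}⊗I|0^{n+1}⟩ = gap(f)/(√2·2ⁿ) — exact Clifford+T amplitudes in FP give P^{#P} = P; doi:10.1098/rspa.1999.0485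 (Fenner–Green–Homer–Pruim 1999: deciding p_acc ≠ 0 exactly is coC=P-complete, NQP = coC=P), tree Literature.Computability.QuantumComplexity.BravyiGosset.ampVal_codeFP / ampValOf_spec (CliffordAmplitudeFP.lean:447–453): exact T-free amplitudes (1/√2)^h(1/2)^N·Γ, Γ ∈ ℤ[i], computed in FP — the archimedean half of the would-be simulator is in the tree, arXiv:2305.10277 Thm 1.1 / 3.1 (Ω̃(t²) ≤ χ_δ ≤ χ over ℂ) + doi:10.22331/q-2021-12-20-606 (χ(T^{⊗t}) ≤ O(2^{0.3963t})) — the archimedean values the modular rank must equal for p > P₀(t) (item ModularRankTransfer), evidence stmt-QuantumAdvantage-1851/ModularCensus_n_le_3.md (refuter 2026-08-15): χ_p(T^{⊗t}) = 2,2,3 = χ_ℂ for t = 1,2,3 at all p ≡ 1 (8) < 200 and all roots; one 𝔽_17-only spanning coincidence at t = 3 without rank drop; t = 4, k = 3 untested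
[crux] HYPOTHESIS-TYPE, CONSENSUS-FALSE (refuters / kit census: yes; provers: do not attempt a
proof). Uniform polynomial MODULAR stabilizer rank of the magic vector at polynomially many primes:
∃ D poly-time in unary (t,k), ∃ c, ∀ t k: D t k lists ≥ k blocks with pairwise distinct primes p ≡ 1
(mod 8), a root r (r⁴ = −1 in ZMod p, i.e. a primitive 8th root of unity, the image of ζ₈) and ≤
(t+k)^c + c pairs (T-free oracle-free Clifford+T circuit C on t wires, coefficient in ZMod p) with
(x ↦ r^{|x|}) = Σ c • ev_p(C)·(Pi.single 0 1) over ZMod p. Reading: ev_p(C)·e₀ is the reduction mod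
𝔓_r = ker(ℤ[ζ₈] → 𝔽_p, ζ₈ ↦ r) of the integral stabilizer vector (√2)^{#H} C|0^t⟩ ∈ ℤ[i]^{2^t}, and
x ↦ r^{|x|} is the reduction of (√2)^t |T⟩^{⊗t}; so the hypothesis says χ_p(T^{⊗t}) ≤ poly at poly
many primes of poly bit-length, with decompositions findable in poly time. This is the card's
'reduce the prime' functor read as a simulation RESOURCE: where rank drops modulo p (the card's
exceptional primes E_t), magic is cheap at p. Its negation for large t is forced by BQP ≠ P
(ModularSimulation); the census ModularCensus (χ_p vs χ_ℂ for n ≤ 4, p < 200) is the first data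
anyone will have on E_n. -/
@[route_item "route-QuantumAdvantage-ModularRank", crux]
def ModularRankPoly : Prop :=
  ∃ D : (t : ℕ) → ℕ → List (ℕ × ℕ × List (Literature.Computability.Cryptography.QCircuit Literature.Computability.Cryptography.cliffordT t × ℕ)), Literature.Computability.Complexity.PolyTimeComputable (fun q : ℕ × ℕ => Literature.Computability.Complexity.boolPair (Computability.unaryEncodeNat q.1) (Computability.unaryEncodeNat q.2)) (fun o : (Σ t : ℕ, List (ℕ × ℕ × List (Literature.Computability.Cryptography.QCircuit Literature.Computability.Cryptography.cliffordT t × ℕ))) => Literature.Computability.Complexity.boolPair (Computability.encodeNat o.1) ((o.2.map fun b => Literature.Computability.Complexity.boolPair (Computability.encodeNat b.1) (Literature.Computability.Complexity.boolPair (Computability.encodeNat b.2.1) ((b.2.2.map fun x => Literature.Computability.Complexity.boolPair x.1.encode (Computability.encodeNat x.2)).foldr Literature.Computability.Complexity.boolPair []))).foldr Literature.Computability.Complexity.boolPair [])) (fun q => ⟨q.1, D q.1 q.2⟩) ∧ ∃ c : ℕ, ∀ t k : ℕ, ((D t k).map Prod.fst).Nodup ∧ k ≤ (D t k).length ∧ ∀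 b ∈ D t k, (b.1.Prime ∧ b.1 % 8 = 1 ∧ ((b.2.1 : ZMod b.1) ^ 4 = -1) ∧ b.2.2.length ≤ (t + k) ^ c + c ∧ (∀ x ∈ b.2.2, x.1.IsOracleFree ∧ x.1.tCount = 0) ∧ (let p : ℕ := b.1; let r : ZMod p := (b.2.1 : ZMod p); let ev : Literature.Computability.Cryptography.QCircuit Literature.Computability.Cryptography.cliffordT t → Matrix (Literature.Computability.Cryptography.QReg t) (Literature.Computability.Cryptography.QReg t) (ZMod p) := (fun C : Literature.Computability.Cryptography.QCircuit Literature.Computability.Cryptography.cliffordT t => (C.gates.map fun q => match q with | .gate .H e => Literature.Computability.Cryptography.placeGate e (Matrix.of fun x y : Literature.Computability.Cryptography.QReg 1 => if x 0 = true ∧ y 0 = true then (-1 : ZMod p) else 1) | .gate .S e => Literature.Computability.Cryptography.placeGate e (Matrix.of fun x y : Literature.Computability.Cryptography.QReg 1 => if x = y then (if x 0 = true then r ^ 2 else (1 : ZMod p)) else 0) | .gate .T _ => 1 | .gate .CNOT e => Literature.Computability.Cryptography.placeGate e (Matrix.of fun x y : Literature.Computability.Cryptography.QReg 2 => if x 0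 = y 0 ∧ x 1 = (y 1 ^^ y 0) then (1 : ZMod p) else 0) | .oracle _ _ => 1).reverse.prod); let magic : Literature.Computability.Cryptography.QReg t → ZMod p := (fun x : Literature.Computability.Cryptography.QReg t => r ^ (Finset.univ.filter fun i => x i = true).card); magic = (b.2.2.map fun x => (x.2 : ZMod p) • (ev x.1).mulVec (Pi.single (fun _ => false) 1 : Literature.Computability.Cryptography.QReg t → ZMod p)).sum))

/-- item stmt-QuantumAdvantage-1793 · crux · rank 4 · open · by planner
why it might fail: t is fixed before p, so every split prime ≥17 binds; no printed lower-bound engine survives at fixed p (LS22/Labib/MT24 archimedean; PSV22's weight separation needs ord_p((1−r)/(1+r)) > weight gap); 𝔽_17-only identities occur at t=3 (census); even c=1 open; at large p it is ExactRankSuperpoly, open.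
sources: evidence stmt-QuantumAdvantage-1851/ModularCensus_n_le_3.md (2026-08-15: the p = 17 spanning coincidence {GHZ, 1_even, (−1)^{e₂}} at t = 3, not over ℂ; χ_p = χ_ℂ for t ≤ 3, p < 200; t = 4, k = 3 untested), arXiv:2106.03214 Thm 1.1 = Thm 3.2 via Lemma 3.1 (PSV22) = tree theorem PelegShpilkaVolk2022_stabilizerRank_magicT_linear_holds (Literature/Computability/QuantumComplexity/StabilizerRankLowerBoundsProofs.lean:1326, χ(T^{⊗n}) > n/100), ibid. lines 941 (exists_hammingNorm_ne_of_isStabFn: |y| ≤ 4r < |z|, combinatorial, transfers to 𝔽_p) and 1276 (hammingNorm_eq_of_flat_eq: separation by ‖(1−ω)/2‖ < ‖(1+ω)/2‖ — archimedean; mod p it needs ((1−r)/(1+r))^{|z|−|y|} ≠ 1, false once ord_p((1−r)/(1+r)) divides the gap), arXiv:2110.07781 Thm 3.1 / 3.2 (Lovitz–Steffan 2022: Moulton refinement via exponentially increasing |amplitudes| — archimedean); arXiv:2107.10551 (Labib 2022: Gowers norms — analytic); arXiv:2305.10277 Thm 1.1 / 3.1, p.4 (MT24: Haar-measure concentration,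 stalls at quadratic — archimedean), arXiv:2605.28586 p.4 (Labib–Russo 2026 status: strongest exact-rank lower bounds Ω(m) [PSV22, Labib22, LS22]; χ(H-type^{⊗4}) = 4 exactly — the tree's magicT is H-type), arXiv:2503.04101 = doi:10.22331/q-2026-07-29-2179 Thm 1 (Kalra–Sinha, Quantum 10 (2026) 2179: ‖c‖₁ ≤ √e(2k)^{(2k+1)/2} for independent terms — an archimedean coefficient bound with no 𝔽_p analogue)
[crux] S-SIDE KILL (the card's finite-field engine C3, typed): for every c there is t ≥ 2 such that
at EVERY prime p ≡ 1 (mod 8) and every r with r⁴ = −1 in ZMod p, every decomposition of x ↦ r^{|x|}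
as a ZMod p-combination of evaluated T-free oracle-free Clifford+T circuits ev_p(C)·e₀ uses more
than t^c + c terms — superpolynomial MODULAR magic uniformly in the prime. Consequences inside the
route: → ¬ModularRankPoly (support SuperpolyKillsPoly: k = 1, exponent 2c, t ≥ 2) — proving it
closes the route refuted:ModularRankPoly, the intended outcome; with ModularRankTransfer →
ExactRankSuperpoly (support ModularToExact). Why this form: over 𝔽_p coefficients are field
elements, so the archimedean obstruction that caps frame/duality arguments (exponentially
ill-conditioned stabilizer Grams, Kalra–Sinha 2025 Thm 1; card stabilizer-frame-conditioning) is
absent; what remains is the combinatorial core (supports = affine subspaces, quadratic phases with i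
↦ r²). Engines to try (attach as --supports lemmas, not items): PSV22's subspace-restriction proof
of Ω(t) transplanted verbatim to 𝔽_p (sanity floor); the relation code 𝒦_t ⊆ 𝔽_p^{N} of linear
relations among reduced stabilizer vectors, -/
@[route_item "route-QuantumAdvantage-ModularRank"]
def ModularRankSuperpoly : Prop :=
  ∀ c : ℕ, ∃ t : ℕ, 2 ≤ t ∧ ∀ p : ℕ, p.Prime → p % 8 = 1 → ∀ r : ZMod p, r ^ 4 = -1 → (let ev : Literature.Computability.Cryptography.QCircuit Literature.Computability.Cryptography.cliffordT t → Matrix (Literature.Computability.Cryptography.QReg t) (Literature.Computability.Cryptography.QReg t) (ZMod p) := (fun C : Literature.Computability.Cryptography.QCircuit Literature.Computability.Cryptography.cliffordT t => (C.gates.map fun q => match q with | .gate .H e => Literature.Computability.Cryptography.placeGate e (Matrix.of fun x y : Literature.Computability.Cryptography.QReg 1 => if x 0 = true ∧ y 0 = true then (-1 : ZMod p) else 1) | .gate .S e => Literature.Computability.Cryptography.placeGate e (Matrix.of fun x y : Literature.Computability.Cryptography.QReg 1 => if x = y then (if x 0 = true then r ^ 2 else (1 : ZMod p)) else 0) | .gate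 .T _ => 1 | .gate .CNOT e => Literature.Computability.Cryptography.placeGate e (Matrix.of fun x y : Literature.Computability.Cryptography.QReg 2 => if x 0 = y 0 ∧ x 1 = (y 1 ^^ y 0) then (1 : ZMod p) else 0) | .oracle _ _ => 1).reverse.prod); let magic : Literature.Computability.Cryptography.QReg t → ZMod p := (fun x : Literature.Computability.Cryptography.QReg t => r ^ (Finset.univ.filter fun i => x i = true).card); ∀ L : List (Literature.Computability.Cryptography.QCircuit Literature.Computability.Cryptography.cliffordT t × ZMod p), (∀ x ∈ L, x.1.IsOracleFree ∧ x.1.tCount = 0) → magic = (L.map fun x => x.2 • (ev x.1).mulVec (Pi.single (fun _ => false) 1 : Literature.Computability.Cryptography.QReg t → ZMod p)).sum → t ^ c + c < L.length)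

/-- item stmt-QuantumAdvantage-1794 · crux · rank 5 · open · by planner
why it might fail: OPEN: only χ(T^{⊗n}) > n/100 is proved (PSV22, tree _holds), Ω̃(n²) in print (MT24 Thm 3.1 via χ_δ ≤ χ) and that Haar-sampling method stalls at quadratic (p.4); upper bound 2^{0.3963n} (QPG21). FALSE only if P^{#P} ⊆ P/poly: the proved tree fact MT24 Thm 1.6 gives ¬(PSharpP ⊆ PPoly) → this item.
sources: tree theorem MehrabanTahmasbi2024_PSharpP_subset_PPoly_of_stabilizerRank_poly_holds (Literature/Computability/QuantumComplexity/StabilizerRankPermanentProofs.lean:413; fact StabilizerRankPermanent.lean:61) = arXiv:2305.10277 Thm 1.6 (p.5), ibid.: its hypothesis `∃ c, ∀ m, stabilizerRank (tensorPow magicT m) ≤ m ^ c + c` is literally ¬ExactRankSuperpoly, so ¬(PSharpP ⊆ PPoly) → ExactRankSuperpoly is two lines of logic over proved tree theorems, tree theorem PelegShpilkaVolk2022_stabilizerRank_magicT_linear_holds (StabilizerRankLowerBoundsProofs.lean:1326; c = 1/100, n₀ = 0) = arXiv:2106.03214 Thm 1.1; §1.5 p.6 ('our techniques seem incapable of proving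 super-linear lower bounds'), arXiv:2305.10277 Thm 1.1 / Thm 3.1 (Ω̃(m²) for every 0<δ<1; p.3: 'for δ = 0 our result holds for any magic state'), p.4 (bottleneck: Haar sampling needs 2^{n/2} T states), Conj. 1.3, tree fact MehrabanTahmasbi2024_approxRank_magicT_quadratic (ApproxStabilizerRankQuadratic.lean:51, NOT yet discharged) + theorem approxStabilizerRank_le_stabilizerRank (StabilizerRank.lean:145), doi:10.22331/q-2021-12-20-606 (Qassim–Pashayan–Gosset 2021: χ(T^{⊗m}) = O(2^{0.3963m})); arXiv:2605.28586 p.4 (Labib–Russo 2026 status line; χ(H-type^{⊗4}) = 4 exactly)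
[crux] S-SIDE CLASSICAL CORE: superpolynomial EXACT stabilizer rank of |T⟩^{⊗t} over ℂ, typed over
the landed StabilizerRank.lean: ∀ c ∃ t, t^c + c < stabilizerRank (tensorPow magicT t). The δ = 0
shadow of Dequantize's kill item 0247 (which asks it for some δ ∈ (0,1) and is STRONGER:
approxStabilizerRank_le_stabilizerRank); previously unfiled on the hub although it is the best-known
open problem of the area (superlinear is open). Inside this route it is the archimedean face of
ModularRankSuperpoly (support ModularToExact via the transfer lemma). Note for provers:
stabilizerRank is an sInf, so any lower bound needs nonemptiness of the decomposition set
(computational basis states are stabilizer states: X = H·S·S·H). -/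
@[route_item "route-QuantumAdvantage-ModularRank"]
def ExactRankSuperpoly : Prop :=
  ∀ c : ℕ, ∃ t : ℕ, t ^ c + c < Literature.Computability.QuantumComplexity.stabilizerRank (Literature.Computability.QuantumComplexity.tensorPow Literature.Computability.QuantumComplexity.magicT t)

/-- item stmt-QuantumAdvantage-1791 · support · rank 2 · open · by planner
why it might fail: As typed only: tree BQP/Classes.P conventions (wire-0 acceptance on Q_n|x0^m⟩, IsUniform encodings, the (t,k)-indexed oracle D), TM2 plumbing. Not verbatim in print: exact BILINEAR stabilizer pairings over ℤ[ζ₈] reduced mod 𝔓_r (AG04/BG16: sesquilinear over ℂ); CRT bound 0 ≤ N, τN ≤ 2^h.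
sources: arXiv:1601.07601 p.7 (T-gadget, postselected outcome 0, P_out(x) = 2^t⟨0^nA^{⊗t}|V†ΠV|0^nA^{⊗t}⟩, postselection probability 2^{-t}); p.6 + App. C (⟨ψ|φ⟩ = b·2^{-p/2}e^{iπm/4} and Π_G|φ⟩ computable exactly in O(n³)), AdlemanDeMarraisHuang1997 / tree def Literature.Computability.QuantumComplexity.BQP_subset_PP (BQP.lean:126) + arXiv:1212.0506 §3 Def. 1/3 (Giles–Selinger 2013: entries in ℤ[1/√2, i], denominator exponents) — N = 2^h·p_acc ∈ ℤ[√2], tree Literature.Computability.QuantumComplexity.BravyiGosset.ampVal_codeFP / ampValOf_spec (CliffordAmplitudeFP.lean:447–453: exact T-free amplitudes as Gaussian-integer Gauss sums in FP) — the exact-arithmetic toolkit exists; reduction mod 𝔓_r is the only new layer, tree fact BravyiGosset2016_stabilizerRank_output_le (StabilizerSimulation.lean:172: gadgetization χ(U|y⟩) ≤ χ(|T⟩^{⊗t})), refuter notes on stmt-QuantumAdvantage-1791 (2026-08-15, three passes incl. gen-1 review 2166a3c6: arithmetic re-derived, one root per prime via τ: T↦ZT and conj: S↦S³, CRT with ⌈(h+2)/4⌉+1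 primes ≥ 17, conventions read back against the tree), twin: route Dequantize item stmt-QuantumAdvantage-0244 DeqStabrankPolyImpliesCollapse — the archimedean simulation theorem, kind support after its retriage gen-1/gen-2 (2026-08-14)
[crux] MODULAR-CRT SIMULATION THEOREM (theorem-target; new-combination; the route's earned content).
Hypothesis = the body of ModularRankPoly verbatim: a poly-time D maps unary (t,k) to ≥ k blocks (p,
r, [(C_j, c_j)]) with distinct primes p ≡ 1 (mod 8), r⁴ = −1 in ZMod p, at most (t+k)^c + c T-free
oracle-free Clifford+T circuits C_j on t wires and coefficients c_j, such that (x ↦ r^{|x|}) = Σ_j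
c_j • ev_p(C_j)·e₀ in (QReg t → ZMod p), where ev_p evaluates H ↦ [[1,1],[1,−1]] (unnormalised), S ↦
diag(1, r²), CNOT ↦ CNOT, first gate first (QCircuit.toMatrix convention). Conclusion:
Literature.Computability.Cryptography.BQP ⊆ Literature.Computability.Complexity.Classes.P. Proof
plan: for the n-th circuit Q_n (uniform, oracle-free; h Hadamards, t T-gates) and input x, replace
each T by a CNOT onto a fresh magic ancilla postselected on 0 (Bravyi–Gosset gadget; postselection
weight exactly 2^{−t}), so p_acc(x) = ‖(Π₁ ⊗ ⟨0^t|) C_n (|x0^m⟩ ⊗ v_t)‖² / 2^h =: N/2^h with C_n =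
2^{−h/2} M_n, M_n a word in {H_u, S, CNOT} with entries in ℤ[i], v_t = Σ_z ζ₈^{|z|}|z⟩, N = Σ_y
ψ'_y·conj(ψ'_y) ∈ ℤ[√2], 0 ≤ N, τN ≤ 2^h (τ: ζ₈ ↦ ζ₈⁵ maps the circuit to another unitary circuit:
τH = −H, τT = ZT). Call -/
@[route_item "route-QuantumAdvantage-ModularRank", crux]
def ModularSimulation : Prop :=
  (∃ D : (t : ℕ) → ℕ → List (ℕ × ℕ × List (Literature.Computability.Cryptography.QCircuit Literature.Computability.Cryptography.cliffordT t × ℕ)), Literature.Computability.Complexity.PolyTimeComputable (fun q : ℕ × ℕ => Literature.Computability.Complexity.boolPair (Computability.unaryEncodeNat q.1) (Computability.unaryEncodeNat q.2)) (fun o : (Σ t : ℕ, List (ℕ × ℕ × List (Literature.Computability.Cryptography.QCircuit Literature.Computability.Cryptography.cliffordT t × ℕ))) => Literature.Computability.Complexity.boolPair (Computability.encodeNat o.1) ((o.2.map fun b => Literature.Computability.Complexity.boolPair (Computability.encodeNat b.1) (Literature.Computability.Complexity.boolPair (Computability.encodeNat b.2.1) ((b.2.2.map fun x => Literature.Computability.Complexity.boolPair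 x.1.encode (Computability.encodeNat x.2)).foldr Literature.Computability.Complexity.boolPair []))).foldr Literature.Computability.Complexity.boolPair [])) (fun q => ⟨q.1, D q.1 q.2⟩) ∧ ∃ c : ℕ, ∀ t k : ℕ, ((D t k).map Prod.fst).Nodup ∧ k ≤ (D t k).length ∧ ∀ b ∈ D t k, (b.1.Prime ∧ b.1 % 8 = 1 ∧ ((b.2.1 : ZMod b.1) ^ 4 = -1) ∧ b.2.2.length ≤ (t + k) ^ c + c ∧ (∀ x ∈ b.2.2, x.1.IsOracleFree ∧ x.1.tCount = 0) ∧ (let p : ℕ := b.1; let r : ZMod p := (b.2.1 : ZMod p); let ev : Literature.Computability.Cryptography.QCircuit Literature.Computability.Cryptography.cliffordT t → Matrix (Literature.Computability.Cryptography.QReg t) (Literature.Computability.Cryptography.QReg t) (ZMod p) := (fun C : Literature.Computability.Cryptography.QCircuit Literature.Computability.Cryptography.cliffordT t => (C.gates.map fun q => match q with | .gate .H e => Literature.Computability.Cryptography.placeGate e (Matrix.of fun x y : Literature.Computability.Cryptography.QReg 1 => if x 0 = true ∧ y 0 = true then (-1 : ZMod p) else 1) | .gate .S e => Literature.Computability.Cryptography.placeGate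 e (Matrix.of fun x y : Literature.Computability.Cryptography.QReg 1 => if x = y then (if x 0 = true then r ^ 2 else (1 : ZMod p)) else 0) | .gate .T _ => 1 | .gate .CNOT e => Literature.Computability.Cryptography.placeGate e (Matrix.of fun x y : Literature.Computability.Cryptography.QReg 2 => if x 0 = y 0 ∧ x 1 = (y 1 ^^ y 0) then (1 : ZMod p) else 0) | .oracle _ _ => 1).reverse.prod); let magic : Literature.Computability.Cryptography.QReg t → ZMod p := (fun x : Literature.Computability.Cryptography.QReg t => r ^ (Finset.univ.filter fun i => x i = true).card); magic = (b.2.2.map fun x => (x.2 : ZMod p) • (ev x.1).mulVec (Pi.single (fun _ => false) 1 : Literature.Computability.Cryptography.QReg t → ZMod p)).sum))) → Literature.Computability.Cryptography.BQP ⊆ Literature.Computability.Complexity.Classes.P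

/-- item stmt-QuantumAdvantage-1795 · support · rank 6 · open · by planner
sources: idea card specialize-the-angle-reduce-the-prime §Mechanism (Theorem P1, Criterion P3), tree ApproxRankTypical.exists_param_of_mem_stabilizerStates / repr_of_mem_stabilizerStates + card_param (ApproxStabilizerRankTypicalProofs.lean): every stabilizer state is c • vec P over a FINITE parameter set (Dehaene–De Moor ℤ₄-phase normal form) — PROVED, tree isStabFn_flat_of_mem (StabilizerRankLowerBoundsProofs.lean:629); named converse VanDenNest2010_expansion_converse (StabilizerNormalForm.lean:110), tree StabilizerRankOver.lean: RepresentableOver.map (l.386), stabilizerRankOver_map_le (l.395), modGateEval_eq_inline (l.406), representableOver_iff_exists_list (l.286) — the ring-generic dictionary and the easy direction (rank drops under ℤ[ζ₈] → ZMod p) are in place, arXiv:quant-ph/0304125 Thm 5ff (Dehaene–De Moor 2003) / arXiv:0811.0898 eq. (3) (Van den Nest 2010) / arXiv:2106.03214 §2.1 (stabilizer functions i^ℓ(−1)^q·1_A), Mathlib: Nat.exists_prime_gt_modEq_one; Matrix.rank / LinearIndependent.map' under ring homs; IsCyclic (ZMod p)ˣ (a root r = g^{(p−1)/8})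
[support] TRANSFER LEMMA = the card's Theorem P1 (provable now; medium formalisation): for each t
there is P₀ such that for every prime p > P₀ with p ≡ 1 (8) and every r with r⁴ = −1 in ZMod p, and
every k, the magic vector x ↦ r^{|x|} is a ZMod p-combination of k evaluated T-free Clifford
circuits IFF tensorPow magicT t is a ℂ-combination of k stabilizer states (both sides monotone in k,
so this is χ_p = χ_ℂ). Proof: (i) the complex dictionary {C|0^t⟩ : C ∈ cliffordCircuits t} is finite
up to the scalars (√2)^{-d} ζ₈^c (structure of stabilizer states: entries
2^{-d/2}·i^{ℓ(x)}(−1)^{q(x)} on an affine subspace, Dehaene–De Moor 2003 / Van den Nest 2010), and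
every ev_p(C)e₀ is the reduction mod 𝔓_r = ker(ζ₈ ↦ r) of the integral vector (√2)^{#H(C)}·C|0^t⟩ ∈
ℤ[i]^{2^t}, the scalar reducing to a unit ((r + r⁷)² = 2 ≠ 0); (ii) tensorPow magicT t =
(√2)^{−t}·(x ↦ ζ₈^{|x|}); (iii) spans of ℚ(ζ₈)-rational vectors: v ∈ span_ℂ(S) ⟺ v ∈
span_{ℚ(ζ₈)}(S); (iv) for each of the finitely many k-sets S of directions with v ∉ span(S) pick a
nonzero (rank S + 1)-minor of [S | v] through the v-column; its norm has finitely many prime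
divisors; outside the union E_t of these and of the primes below den -/
@[route_item "route-QuantumAdvantage-ModularRank"]
def ModularRankTransfer : Prop :=
  ∀ t : ℕ, ∃ P₀ : ℕ, ∀ p : ℕ, P₀ < p → p.Prime → p % 8 = 1 → ∀ r : ZMod p, r ^ 4 = -1 → (let ev : Literature.Computability.Cryptography.QCircuit Literature.Computability.Cryptography.cliffordT t → Matrix (Literature.Computability.Cryptography.QReg t) (Literature.Computability.Cryptography.QReg t) (ZMod p) := (fun C : Literature.Computability.Cryptography.QCircuit Literature.Computability.Cryptography.cliffordT t => (C.gates.map fun q => match q with | .gate .H e => Literature.Computability.Cryptography.placeGate e (Matrix.of fun x y : Literature.Computability.Cryptography.QReg 1 => if x 0 = true ∧ y 0 = true then (-1 : ZMod p) else 1) | .gate .S e => Literature.Computability.Cryptography.placeGate e (Matrix.of fun x y : Literature.Computability.Cryptography.QReg 1 => if x = y then (if x 0 = true then r ^ 2 else (1 : ZMod p)) else 0) | .gate .T _ => 1 | .gate .CNOT e => Literature.Computability.Cryptography.placeGate e (Matrix.of fun x y : Literature.Computability.Cryptography.QReg 2 => if x 0 = y 0 ∧ x 1 = (y 1 ^^ y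 0) then (1 : ZMod p) else 0) | .oracle _ _ => 1).reverse.prod); let magic : Literature.Computability.Cryptography.QReg t → ZMod p := (fun x : Literature.Computability.Cryptography.QReg t => r ^ (Finset.univ.filter fun i => x i = true).card); ∀ k : ℕ, (∃ L : List (Literature.Computability.Cryptography.QCircuit Literature.Computability.Cryptography.cliffordT t × ZMod p), (∀ x ∈ L, x.1.IsOracleFree ∧ x.1.tCount = 0) ∧ L.length = k ∧ magic = (L.map fun x => x.2 • (ev x.1).mulVec (Pi.single (fun _ => false) 1 : Literature.Computability.Cryptography.QReg t → ZMod p)).sum) ↔ (∃ (c : Fin k → ℂ) (φ : Fin k → Literature.Computability.Cryptography.QReg t → ℂ), (∀ i, φ i ∈ Literature.Computability.QuantumComplexity.stabilizerStates t) ∧ Literature.Computability.QuantumComplexity.tensorPow Literature.Computability.QuantumComplexity.magicT t = ∑ i, c i • φ i))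

/-- item stmt-QuantumAdvantage-1796 · support · rank 7 · open · by planner
[support] GLUE (pure logic, provable now): ModularRankSuperpoly → ¬ModularRankPoly. Given D, c from
ModularRankPoly, apply ModularRankSuperpoly with exponent 2c to get t ≥ 2; D t 1 has a block (p, r,
L) with p ≡ 1 (8), r⁴ = −1, L.length ≤ (t+1)^c + c ≤ t^{2c} + 2c (as t + 1 ≤ t² for t ≥ 2) and the
decomposition identity; map L to List (QCircuit × ZMod p) by casting coefficients (List.map_map,
length preserved) and contradict. Makes the kill path explicit: a Theorems proof of
ModularRankSuperpoly plus this glue refutes ModularRankPoly and BREAKS the route as intended. -/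
@[route_item "route-QuantumAdvantage-ModularRank"]
def SuperpolyKillsPoly : Prop :=
  ModularRankSuperpoly → ¬ ModularRankPoly

/-- item stmt-QuantumAdvantage-1797 · support · rank 8 · open · by planner
sources: Mathlib Nat.exists_prime_gt_modEq_one (primes ≡ 1 mod k), ZMod.unitsEquivInt / IsCyclic (ZMod p)ˣ, tree StabilizerRank.lean (stabilizerRank as sInf; design note on nonemptiness)
[support] GLUE: ModularRankSuperpoly → ModularRankTransfer → ExactRankSuperpoly. Given c, take t ≥ 2
from Superpoly(c) and P₀ from Transfer(t); pick a prime p > P₀ with p ≡ 1 (mod 8) (Mathlib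
Nat.exists_prime_gt_modEq_one) and r : ZMod p with r⁴ = −1 (ZMod p cyclic of order p − 1, 8 ∣ p − 1:
r := g^{(p−1)/8}); Superpoly forbids modular representations of length ≤ t^c + c, Transfer (monotone
in k) forbids complex ones with ≤ t^c + c terms, and the sInf defining stabilizerRank exceeds t^c +
c once the decomposition set is nonempty (computational-basis expansion: |x⟩ = Π X_i |0^t⟩ with X =
H S S H ∈ cliffordCircuits t, 2^t terms). Shows the modular kill dominates the archimedean one. -/
@[route_item "route-QuantumAdvantage-ModularRank"]
def ModularToExact : Prop :=
  ModularRankSuperpoly → ModularRankTransfer → ExactRankSuperpoly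

/-- item stmt-QuantumAdvantage-17858 · support · rank 9 · open · by planner
why it might fail: TRUE as mathematics; as typed only: unary pair encodings, Bool output via Computability.encodeBool, foldr-boolPair list encodings must match ModularRankPoly's verbatim (they are copied from it); filter/map closure of PolyTimeComputable is not yet in the tree (only comp/const/id).
sources: tree Literature/Computability/Complexity/TimeBounds.lean:125 (PolyTimeComputable), TimeBoundsProofs.lean:674 (PolyTimeComputable.comp_holds), PCPProofs.lean:45 (PolyTimeComputable.const), NPBridge.lean:328–336 (precomp / of_output_eq), AroraBarak2009 §1.2–1.3 (poly-time closure under composition; machine constructions), Cruxes/ModularRankPoly/Split.lean @f075664164d8 (Split.ModularRankPoly_of_subs)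
[support] THEOREM-TARGET, TRUE, provable now (pure complexity plumbing over the tree's TM2
PolyTimeComputable; no magic, no number theory) — the COMPLEXITY piece of ModularRankPoly
(strategist split 2026-08-17). For every exponent d, every recogniser P : ℕ → ℕ → Bool poly-time on
unary (t,p) with Boolean output, and every per-prime map F t p : ℕ × List (QCircuit cliffordT t × ℕ)
poly-time on unary (t,p) (output encoded as in ModularRankPoly's blocks), the LISTING (t,k) ↦ ⟨t,
[(p, F t p) : p ∈ range ((t+k)^d + d), p prime, p ≡ 1 (mod 8), P t p]⟩ is PolyTimeComputable from
boolPair (unary t) (unary k) into ModularRankPoly's output encoding. Proof plan: enumerate the range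
(poly(t+k) values), trial-division primality and residue mod 8 (poly in the VALUE p ≤ (t+k)^d + d),
call P and F on unary arguments of length O(t + p) = poly(t+k) (so each call is poly-time by the
hypotheses; at most (t+k)^d + d calls), concatenate the encoded blocks with boolPair/foldr. Tree
tools: PolyTimeComputable.comp_holds (TimeBoundsProofs.lean:674), PolyTimeComputable.const/id,
of_encode_eq/of_output_eq (NPBridge.lean, RandomizedProofs.lean), boolPair API (BoolEncodings.lean).
With DenseModularDecomposer it -/
@[route_item "route-QuantumAdvantage-ModularRank"]
def DecomposerListingPolyTime : Prop :=
  ∀ (d : ℕ) (P : ℕ → ℕ → Bool) (F : (t : ℕ) → ℕ → ℕ × List (Literature.Computability.Cryptography.QCircuit Literature.Computability.Cryptography.cliffordT t × ℕ)), Literature.Computability.Complexity.PolyTimeComputable (fun q : ℕ × ℕ => Literature.Computability.Complexity.boolPair (Computability.unaryEncodeNat q.1) (Computability.unaryEncodeNat q.2)) Computability.encodeBool (fun q => P q.1 q.2) → Literature.Computability.Complexity.PolyTimeComputable (fun q : ℕ × ℕ => Literature.Computability.Complexity.boolPair (Computability.unaryEncodeNat q.1) (Computability.unaryEncodeNat q.2))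 (fun o : (Σ t : ℕ, ℕ × List (Literature.Computability.Cryptography.QCircuit Literature.Computability.Cryptography.cliffordT t × ℕ)) => Literature.Computability.Complexity.boolPair (Computability.encodeNat o.1) (Literature.Computability.Complexity.boolPair (Computability.encodeNat o.2.1) ((o.2.2.map fun x => Literature.Computability.Complexity.boolPair x.1.encode (Computability.encodeNat x.2)).foldr Literature.Computability.Complexity.boolPair []))) (fun q => ⟨q.1, F q.1 q.2⟩) → Literature.Computability.Complexity.PolyTimeComputable (fun q : ℕ × ℕ => Literature.Computability.Complexity.boolPair (Computability.unaryEncodeNat q.1) (Computability.unaryEncodeNat q.2)) (fun o : (Σ t : ℕ, List (ℕ × ℕ × List (Literature.Computability.Cryptography.QCircuit Literature.Computability.Cryptography.cliffordT t × ℕ))) => Literature.Computability.Complexity.boolPair (Computability.encodeNat o.1) ((o.2.map fun b => Literature.Computability.Complexity.boolPair (Computability.encodeNat b.1) (Literature.Computability.Complexity.boolPair (Computability.encodeNat b.2.1) ((b.2.2.map fun x => Literature.Computability.Complexity.boolPair x.1.encode (Computability.encodeNat x.2)).foldr Literature.Computability.Complexity.boolPair []))).foldr Literature.Computability.Complexity.boolPair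 [])) (fun q => ⟨q.1, ((List.range ((q.1 + q.2) ^ d + d)).filter fun p => decide (p.Prime ∧ p % 8 = 1 ∧ P q.1 p = true)).map fun p => (p, F q.1 p)⟩)

/-- item stmt-QuantumAdvantage-17859 · support · rank 9 · open · by planner
sources: Cruxes/ModularRankPoly/Split.lean @f075664164d8 (Split.ModularRankPoly_of_subs)
[support] GLUE of the strategist split (PROVABLE NOW — proof exists): DenseModularDecomposer →
DecomposerListingPolyTime → ModularRankPoly, kernel-checked as
Summit.QuantumAdvantage.QuantumAdvantage.Cruxes.ModularRankPoly.Split.ModularRankPoly_of_subs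
(Cruxes/ModularRankPoly/Split.lean @f075664164d8: rc0, 0 sorry, axioms
propext/Classical.choice/Quot.sound; its hypotheses are these two items' statements verbatim). A
prover closes this item by landing that proof in Theorems/ (e.g.
Theorems/ModularRankModularRankPolyOfSplit.lean: copy the ~40-line proof; route-context one-liner
`fun h₁ h₂ => Split.ModularRankPoly_of_subs h₁ h₂` if the Cruxes module is importable). Once closed,
ModularRankPoly is DERIVED from the two pieces; the formal `route edit --split ModularRankPoly
--into children.json --glue-by <this theorem>` (final-cycle/tenure verb) then only records the
parent/child structure. [deps: DenseModularDecomposer, DecomposerListingPolyTime] [difficulty: S] -/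
@[route_item "route-QuantumAdvantage-ModularRank"]
def ModularRankPolyOfSplit : Prop :=
  DenseModularDecomposer → DecomposerListingPolyTime → ModularRankPoly

-- item stmt-QuantumAdvantage-1851 · support · rank 9 · open · by planner — informal only, no Lean statement yet:
--   [support] EXCEPTIONAL-PRIMES CENSUS (card C1; informal until someone types a concrete finite claim):
--   compute, for n ≤ 4 (n = 5 if feasible with Clifford-orbit reduction), the modular stabilizer rank
--   χ_p(T^⊗n) — least k such that x ↦ r^{|x|} is a ZMod p-combination of k evaluated T-free Clifford
--   circuits, any r with r⁴ = −1 — for every prime p ≡ 1 (mod 8), p < 200 (17, 41, 73, 89, 97, 113, 137,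
--   193), and compare with the complex ranks χ(T^⊗2) = 2, χ(T^⊗3) = 3, χ(T^⊗4) ≤ 4 (BSS16/QPG21).
--   Method: enumerate the finite set of integral stabilizer directions (entries in {0, ±1, ±i} on affine
--   subspace

-- earlier Assembly (stmt-QuantumAdvantage-1798, replaced 2026-08-15T16:14:56Z -> stmt-QuantumAdvantage-10412): retired by None — ModularSimulation → ModularRankPoly → Literature.Computability.QuantumComplexity.BPP_subset_BQP → ¬ QuantumAdvantage
/-- item stmt-QuantumAdvantage-10412 · assembly · rank 1 · open · by planner
[assembly] ModularSimulation → ModularRankPoly → ¬QuantumAdvantage (refutation side; proof = the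
two-line deciding theorem `closes`): the hypothesis of ModularSimulation is the body of
ModularRankPoly verbatim, so BQP ⊆ Classes.P; P ⊆ BPP is the DISCHARGED tree theorem
Literature.Computability.Complexity.P_subset_BPP_holds (ProbabilisticClassesProofs.lean, Gill 1977
Prop. 5.1), hence no L ∈ BQP ∖ BPP. Repair 2026-08-15 (route-repair, glue.extra-hypothesis): the
former third hypothesis Literature.Computability.QuantumComplexity.BPP_subset_BQP
(BernsteinVazirani1997 §8) was never used by the proof and is dropped — the existential summit form
needs only BQP ⊆ BPP. -/
@[route_item "route-QuantumAdvantage-ModularRank"]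
def Assembly : Prop :=
  ModularSimulation → ModularRankPoly → ¬ _root_.QuantumAdvantage

/-! D-0027 §2.1 — DECIDING THEOREM (planner-authored via `route open/edit --closes-file`; by planner-rbadge-QuantumAdvantage-ModularRank-3d03a5a5-g2-0 2026-08-15T16:14:56Z):
its hypotheses are this route's items and its conclusion the sub-problem Statement (glue_lint), and it elaborates with this file. -/

@[closes "route-QuantumAdvantage-ModularRank"] theorem closes (h₁ : ModularSimulation) (h₂ : ModularRankPoly) : ¬ _root_.QuantumAdvantage :=
  fun ⟨_, hL, hnL⟩ => hnL (Literature.Computability.Complexity.P_subset_BPP_holds (h₁ h₂ hL))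

end Summit.QuantumAdvantage.QuantumAdvantage.Theses.ModularRank
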